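import Summits.QuantumFields.YangMills.Theorems.UnitScaleTiltProp7CurvedLandauCoreFinalT3
import Summits.QuantumFields.YangMills.Theorems.UnitScaleTiltProp7PointLandauBudget
import HarnessLib

/-!
# Route `UnitScaleTilt`, crux K1 «MinimiserStabilityRegPr» (stmt-QuantumFields-19200), route-R (Λ) — THE CURVED CORE IN RELATIVE-PLAQUETTE CURRENCY FOR A
# GENERIC COMPETITOR: ✓ `Prop7CurvedLandauCoreFinalT3.sum_normSq_le_curl_sq_core_T3` ∘ (ii′) ✓ `Prop7RelPlaqVsCovCurl.sum_hs_curl_le_relPlaq_T3`, the recursion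
# families `G ∕ S ∕ Λ` ELIMINATED, the divergence budget `(δ, Z)` then DISCHARGED on the Landau slice (`δ = Z = 0`) and at the unpinned `ℓ²`-optimum (`δ = 6s²`, `Z = 0`)

Cell `ym3-torus`, keyed width hand `ym-routeR-w2` (D-0154 (3c), gen 1; OFFER (o1) on the cell bus 2026-08-28).  THEOREMS ONLY (0 `def`, 0 `sorry`);
`--supports stmt-QuantumFields-19200`, count-neutral.  YM₃ on T³ is a ladder rung (R3), not the Clay problem; nothing here claims the stub, the crux, d = 4 or the mass gap.

WHY.  After ★p1's S4-curved verdict (cell bus 10:04:53Z) and OWNER RULING №25 the route-R relative Poincaré inequality is pursued for the covariant LANDAU ∕ unpinned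
`ℓ²`-optimal representative ((Λ) of record).  The structure-row-free core ✓ p622368 is stated for a generic bond field `Y` with a covariant-curl right-hand side and
displays the three recursion families `G, S, Λ` of the curved tower although — once ★routeR-w2 g0's `hΛcurl` row is discharged inside it — they no longer occur in its
conclusion.  This file states the core ONCE in the currency every consumer uses: `Y := WU₀^* − 1` for an ARBITRARY competitor `W` (no fibre hypothesis, no optimality),
relative plaquettes `R_p = W(∂p)U₀(∂p)^*` on the right, the families obtained internally (`exists_reduced_family`, `exists_pureLine_family`, `exists_coarseGauge_family`),
so that exactly five rows stay displayed: the (14)-type plaquette bound of `U₀`, the true linearisation `Q` of the `(K−n)`-fold average (text of ✓ p622368 verbatim),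
the divergence budget `(δ, Z)`, the constraint-velocity budget `ZQ ≥ Σ_c‖Q_{K−n}(Y)(c)‖²`, and the sup radius `s`.  The two corollaries discharge `(δ, Z)`:
on the Landau slice `D^*_{U₀}Y = 0` (RULING №25's letter) `δ = Z = 0`; at the UNPINNED `ℓ²`-optimum (`W` optimal over its full gauge orbit relative to `U₀`, the
letter of ✓ `Prop7PointLandauBudget.sum_hs_divB_le_of_optAll` ∕ ★routeR-w1's `…OptimalReprAllExists`) `δ = 6s²`, `Z = 0`.  What then stays displayed is `ZQ` and `s`
— for an off-fibre representative `W^u` the budget `ZQ` carries, besides the on-fibre remainder, the coarse drift `V^{u↓}V^* − 1` (`V^{u↓} = avg^{K−n}(W^u)`); nothing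
about either is asserted here.

WHAT IS PROVED (ns `…Theorems.Prop7CurvedLandauCoreBudgetsRelPlaqT3`).
* §1 ★★★ `relPoincare_core_of_budgets_T3`:
  `((1∕2)ℓ⁻² − A·δ − A·(24576s² + 768(εℓ⁻²)²))·Σ_b‖Y_b‖² − A·Z − 96ℓ⁻¹·ZQ ≤ A·4·Σ_p‖R_p − 1‖²`, `A = 18 + 76800L⁴`, `ℓ = L^{K−n}`, under `2·10¹³·L⁹·ε ≤ 1`, `s ≤ 1`.
* §2 ★★ `relPoincare_core_of_landau_T3` (`D^*_{U₀}Y = 0` pointwise ⇒ `δ = Z = 0`).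
* §3 ★★ `relPoincare_core_of_optAll_T3` (`W` `ℓ²`-optimal over its FULL gauge orbit ⇒ `δ = 6s²`, `Z = 0`; rate `(1∕2)ℓ⁻² − A·(24582s² + 768(εℓ⁻²)²)`).

HONEST SCOPE.  Three `obtain`s, one application of ✓ p622368, the eight-line (ii′) re-run of ✓ `…CoreFinalT3.relPoincare_core_of_fibre_T3'`, and two substitutions;
nothing of Bałaban's analysis is asserted; the displayed `ZQ`, `s` are genuine.

References: T. Bałaban, CMP 99 (1985) 389–434 [Balaban1985BackgroundPropagators] (Thm 3.11 p.416, (3.8) p.392); CMP 102 (1985) 277–309 [Balaban1985Variational]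
((14)–(15) p.280, (141)–(143) p.299); CMP 99 (1985) 75–102 [Balaban1985RegularSpaces] ((1.38) p.82).
-/

set_option autoImplicit false

noncomputable section

open scoped BigOperators Matrix.Norms.L2Operator Matrix

namespace Summit.QuantumFields.YangMills.Theorems.Prop7CurvedLandauCoreBudgetsRelPlaqT3

open Literature.MathematicalPhysics.QuantumFieldTheory.Balaban1983to89
open Literature.MathematicalPhysics.QuantumFieldTheory.Balaban1983to89.T3ContinuumYM3Torus
open Finset T4Continuum T4ReflectionCone BlockAveraging AveragingRT ExpMeanLog BlockAveragingEMLLinearised BlockAveragingEMLLinearisedBackground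
  BlockAveragingEMLProp2 B1RG242Torus
open B15DeterminingSets (embIter)
open B7Prop1Explicit (treeWord)
open B7Eq78Linearization (conjR)
open B9Eq39Adjoint (curl divB)
open B10Eq27TorusAxialLog (holT unitsField toUField)
open B9TorusCalculus (torusT)
open Summit.QuantumFields.YangMills.Theorems.Prop7CurvedLandauKnitT3 (three_le_L)
open Summit.QuantumFields.YangMills.Theorems.Prop7CurvedLandauCoreFinalT3 (sum_normSq_le_curl_sq_core_T3)
open Summit.QuantumFields.YangMills.Theorems.Prop7CurvedLandauRowA (exists_reduced_family exists_coarseGauge_family)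
open Summit.QuantumFields.YangMills.Theorems.Prop7LineIterVsEngineOfTower (exists_pureLine_family)
open Summit.QuantumFields.YangMills.Theorems.Prop7RelPlaqVsCovCurl (sum_hs_curl_le_relPlaq_T3)
open Summit.QuantumFields.YangMills.Theorems.Prop7PointLandauBudget (sum_hs_divB_le_of_optAll)

/-! ## §1 ★★★ The core in relative-plaquette currency for a generic competitor, five rows displayed -/

/-- ★★★ **THE CURVED CORE OF ROUTE-R's P IN RELATIVE-PLAQUETTE CURRENCY, GENERIC COMPETITOR** (d = 3, SU(2)).  Background `U₀` with plaquettes within `ε·ℓ⁻²`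
(`ℓ = L^{K−n}`, `2·10¹³·L⁹·ε ≤ 1`), ANY competitor `W` with `Y_b = W_bU₀(b)^* − 1`, `‖Y_b‖ ≤ s ≤ 1`; displayed budgets: divergence `Σ_x‖(D^*_{U₀}Y)(x)‖²_HS ≤ δ·Σ‖Y‖² + Z`,
constraint velocity `Σ_c‖Q_{K−n}(Y)(c)‖² ≤ ZQ` for the true linearisation `Q` of the `(K−n)`-fold (0.4)-average along the background tower.  THEN
`((1∕2)ℓ⁻² − A·δ − A·(24576s² + 768(εℓ⁻²)²))·Σ_b‖Y_b‖² − A·Z − 96ℓ⁻¹·ZQ ≤ A·4·Σ_p‖W(∂p)U₀(∂p)^* − 1‖²`, `A = 18 + 76800L⁴` — the recursion families of ✓ p622368 are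
obtained inside and do not appear. [cite: Balaban1985BackgroundPropagators, Thm 3.11 p.416; Balaban1985Variational, (14)-(15) p.280, (141)-(143) p.299] -/
theorem relPoincare_core_of_budgets_T3 (F : T3Family) (n K : ℕ)
    (U₀ W : GaugeField (F.P K) 0 (Matrix.specialUnitaryGroup (Fin 2) ℂ)) {ε : ℝ} (hε : 0 < ε) (hεL : 20000000000000 * (F.L : ℝ) ^ 9 * ε ≤ 1)
    (hU : ∀ p : Plaq (F.P K) 0, dist1 (GaugeField.plaqHol U₀ p) ≤ ε * (((F.L : ℝ) ^ (K - n)) ^ 2)⁻¹)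
    (Q : (k : ℕ) → (PBond (F.P K) 0 → Matrix (Fin 2) (Fin 2) ℂ) → PBond (F.P K) k → Matrix (Fin 2) (Fin 2) ℂ) (hQ0 : ∀ Y, Q 0 Y = Y)
    (hQs : ∀ (k : ℕ) (Y : PBond (F.P K) 0 → Matrix (Fin 2) (Fin 2) ℂ) (c : PBond (F.P K) (k + 1)), Q (k + 1) Y c
      = fderiv ℂ (eml : (Idx (F.P K) → Matrix (Fin 2) (Fin 2) ℂ) → Matrix (Fin 2) (Fin 2) ℂ)
            (fun i => ((loopHol (Averaging.iter (fun i => blockAvg (P := F.P K) (j := i) (expMeanLogSU (n := Fin 2))) k U₀) c i :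
              Matrix.specialUnitaryGroup (Fin 2) ℂ) : Matrix (Fin 2) (Fin 2) ℂ))
            (fun i => covWalkSum (Averaging.iter (fun i => blockAvg (P := F.P K) (j := i) (expMeanLogSU (n := Fin 2))) k U₀) (Q k Y)
                (walk (emb c.src) (loopWord (F.P K).L c.dir (off i.1) i.2.1 i.2.2))
              * ((loopHol (Averaging.iter (fun i => blockAvg (P := F.P K) (j := i) (expMeanLogSU (n := Fin 2))) k U₀) c i :
                Matrix.specialUnitaryGroup (Fin 2) ℂ) : Matrix (Fin 2) (Fin 2) ℂ))
            * star ((corr (expMeanLogSU (n := Fin 2)) (Averaging.iter (fun i => blockAvg (P := F.P K) (j := i) (expMeanLogSU (n := Fin 2))) k U₀) c :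
                Matrix.specialUnitaryGroup (Fin 2) ℂ) : Matrix (Fin 2) (Fin 2) ℂ)
          + ((corr (expMeanLogSU (n := Fin 2)) (Averaging.iter (fun i => blockAvg (P := F.P K) (j := i) (expMeanLogSU (n := Fin 2))) k U₀) c :
                Matrix.specialUnitaryGroup (Fin 2) ℂ) : Matrix (Fin 2) (Fin 2) ℂ)
            * covWalkSum (Averaging.iter (fun i => blockAvg (P := F.P K) (j := i) (expMeanLogSU (n := Fin 2))) k U₀) (Q k Y)
                (walk (emb c.src) (List.replicate (F.P K).L (c.dir, true)))
            * star ((corr (expMeanLogSU (n := Fin 2)) (Averaging.iter (fun i => blockAvg (P := F.P K) (j := i) (expMeanLogSU (n := Fin 2))) k U₀) c :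
                Matrix.specialUnitaryGroup (Fin 2) ℂ) : Matrix (Fin 2) (Fin 2) ℂ))
    {δ Z : ℝ}
    (hdivB : (∑ x : Site (F.P K) 0, ∑ j : Fin 2, ∑ k : Fin 2,
            ‖(divB (torusT (F.P K) 0) (fun κ z => unitsField (toUField U₀) ⟨z, κ⟩) (fun κ z => pertVar U₀ W ⟨z, κ⟩) x) j k‖ ^ 2)
      ≤ δ * (∑ b : PBond (F.P K) 0, ‖pertVar U₀ W b‖ ^ 2) + Z)
    {ZQ : ℝ} (hQ : ∑ c : PBond (F.P K) (K - n), ‖Q (K - n) (pertVar U₀ W) c‖ ^ 2 ≤ ZQ)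
    {s : ℝ} (hδW : ∀ b : PBond (F.P K) 0, ‖pertVar U₀ W b‖ ≤ s) (hs1 : s ≤ 1) :
    ((1 / 2) * (((F.L : ℝ) ^ (K - n)) ^ 2)⁻¹ - (18 + 76800 * (F.L : ℝ) ^ 4) * δ
        - (18 + 76800 * (F.L : ℝ) ^ 4) * (24576 * s ^ 2 + 768 * (ε * (((F.L : ℝ) ^ (K - n)) ^ 2)⁻¹) ^ 2)) * (∑ b : PBond (F.P K) 0, ‖pertVar U₀ W b‖ ^ 2)
        - (18 + 76800 * (F.L : ℝ) ^ 4) * Z - 96 * ((F.L : ℝ) ^ (K - n))⁻¹ * ZQ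
      ≤ (18 + 76800 * (F.L : ℝ) ^ 4) * (4 * ∑ p : Plaq (F.P K) 0,
        ‖((GaugeField.plaqHol W p : Matrix.specialUnitaryGroup (Fin 2) ℂ) : Matrix (Fin 2) (Fin 2) ℂ)
          * star ((GaugeField.plaqHol U₀ p : Matrix.specialUnitaryGroup (Fin 2) ℂ) : Matrix (Fin 2) (Fin 2) ℂ) - 1‖ ^ 2) := by
  obtain ⟨G, hG0, hGs⟩ := exists_reduced_family U₀ (pertVar U₀ W)
  obtain ⟨S, hS0, hSs⟩ := exists_pureLine_family U₀ (pertVar U₀ W)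
  obtain ⟨Λ, hΛ0, hΛs⟩ := exists_coarseGauge_family U₀ G
  have hcore := sum_normSq_le_curl_sq_core_T3 F n K U₀ hε hεL hU Q hQ0 hQs (pertVar U₀ W) G S Λ hG0 hS0 hΛ0 hΛs hGs hSs hdivB hQ
  have hδ' : ∀ b : PBond (F.P K) 0, ‖(W b : Matrix (Fin 2) (Fin 2) ℂ) * star (U₀ b : Matrix (Fin 2) (Fin 2) ℂ) - 1‖ ≤ s := fun b => by
    rw [← pertVar_eq]; exact hδW b
  have hc := sum_hs_curl_le_relPlaq_T3 F n K W U₀ hU hδ' hs1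
  simp only [← pertVar_eq] at hc
  have hA0 : (0 : ℝ) ≤ 18 + 76800 * (F.L : ℝ) ^ 4 := by positivity
  have hc' := mul_le_mul_of_nonneg_left hc hA0
  linarith only [hcore, hc']

/-! ## §2 ★★ On the Landau slice: `δ = Z = 0` -/

/-- ★★ **THE CORE ON THE COVARIANT LANDAU SLICE** (OWNER RULING №25's letter `D^*_{U₀}(WU₀^* − 1) = 0`): with `(D^*_{U₀}Y)(x) = 0` at every site the divergence budget is
`δ = Z = 0`, so `((1∕2)ℓ⁻² − A·(24576s² + 768(εℓ⁻²)²))·Σ_b‖Y_b‖² − 96ℓ⁻¹·ZQ ≤ A·4·Σ_p‖R_p − 1‖²`; displayed: (14), `Q`, `ZQ`, `s`.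
[cite: Balaban1985BackgroundPropagators, Thm 3.11 p.416, (3.8) p.392; Balaban1985Variational, (141)-(143) p.299] -/
theorem relPoincare_core_of_landau_T3 (F : T3Family) (n K : ℕ)
    (U₀ W : GaugeField (F.P K) 0 (Matrix.specialUnitaryGroup (Fin 2) ℂ)) {ε : ℝ} (hε : 0 < ε) (hεL : 20000000000000 * (F.L : ℝ) ^ 9 * ε ≤ 1)
    (hU : ∀ p : Plaq (F.P K) 0, dist1 (GaugeField.plaqHol U₀ p) ≤ ε * (((F.L : ℝ) ^ (K - n)) ^ 2)⁻¹)
    (Q : (k : ℕ) → (PBond (F.P K) 0 → Matrix (Fin 2) (Fin 2) ℂ) → PBond (F.P K) k → Matrix (Fin 2) (Fin 2) ℂ) (hQ0 : ∀ Y, Q 0 Y = Y)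
    (hQs : ∀ (k : ℕ) (Y : PBond (F.P K) 0 → Matrix (Fin 2) (Fin 2) ℂ) (c : PBond (F.P K) (k + 1)), Q (k + 1) Y c
      = fderiv ℂ (eml : (Idx (F.P K) → Matrix (Fin 2) (Fin 2) ℂ) → Matrix (Fin 2) (Fin 2) ℂ)
            (fun i => ((loopHol (Averaging.iter (fun i => blockAvg (P := F.P K) (j := i) (expMeanLogSU (n := Fin 2))) k U₀) c i :
              Matrix.specialUnitaryGroup (Fin 2) ℂ) : Matrix (Fin 2) (Fin 2) ℂ))
            (fun i => covWalkSum (Averaging.iter (fun i => blockAvg (P := F.P K) (j := i) (expMeanLogSU (n := Fin 2))) k U₀) (Q k Y)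
                (walk (emb c.src) (loopWord (F.P K).L c.dir (off i.1) i.2.1 i.2.2))
              * ((loopHol (Averaging.iter (fun i => blockAvg (P := F.P K) (j := i) (expMeanLogSU (n := Fin 2))) k U₀) c i :
                Matrix.specialUnitaryGroup (Fin 2) ℂ) : Matrix (Fin 2) (Fin 2) ℂ))
            * star ((corr (expMeanLogSU (n := Fin 2)) (Averaging.iter (fun i => blockAvg (P := F.P K) (j := i) (expMeanLogSU (n := Fin 2))) k U₀) c :
                Matrix.specialUnitaryGroup (Fin 2) ℂ) : Matrix (Fin 2) (Fin 2) ℂ)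
          + ((corr (expMeanLogSU (n := Fin 2)) (Averaging.iter (fun i => blockAvg (P := F.P K) (j := i) (expMeanLogSU (n := Fin 2))) k U₀) c :
                Matrix.specialUnitaryGroup (Fin 2) ℂ) : Matrix (Fin 2) (Fin 2) ℂ)
            * covWalkSum (Averaging.iter (fun i => blockAvg (P := F.P K) (j := i) (expMeanLogSU (n := Fin 2))) k U₀) (Q k Y)
                (walk (emb c.src) (List.replicate (F.P K).L (c.dir, true)))
            * star ((corr (expMeanLogSU (n := Fin 2)) (Averaging.iter (fun i => blockAvg (P := F.P K) (j := i) (expMeanLogSU (n := Fin 2))) k U₀) c :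
                Matrix.specialUnitaryGroup (Fin 2) ℂ) : Matrix (Fin 2) (Fin 2) ℂ))
    (hdiv : ∀ x : Site (F.P K) 0,
      divB (torusT (F.P K) 0) (fun κ z => unitsField (toUField U₀) ⟨z, κ⟩) (fun κ z => pertVar U₀ W ⟨z, κ⟩) x = 0)
    {ZQ : ℝ} (hQ : ∑ c : PBond (F.P K) (K - n), ‖Q (K - n) (pertVar U₀ W) c‖ ^ 2 ≤ ZQ)
    {s : ℝ} (hδW : ∀ b : PBond (F.P K) 0, ‖pertVar U₀ W b‖ ≤ s) (hs1 : s ≤ 1) :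
    ((1 / 2) * (((F.L : ℝ) ^ (K - n)) ^ 2)⁻¹
        - (18 + 76800 * (F.L : ℝ) ^ 4) * (24576 * s ^ 2 + 768 * (ε * (((F.L : ℝ) ^ (K - n)) ^ 2)⁻¹) ^ 2)) * (∑ b : PBond (F.P K) 0, ‖pertVar U₀ W b‖ ^ 2)
        - 96 * ((F.L : ℝ) ^ (K - n))⁻¹ * ZQ
      ≤ (18 + 76800 * (F.L : ℝ) ^ 4) * (4 * ∑ p : Plaq (F.P K) 0,
        ‖((GaugeField.plaqHol W p : Matrix.specialUnitaryGroup (Fin 2) ℂ) : Matrix (Fin 2) (Fin 2) ℂ)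
          * star ((GaugeField.plaqHol U₀ p : Matrix.specialUnitaryGroup (Fin 2) ℂ) : Matrix (Fin 2) (Fin 2) ℂ) - 1‖ ^ 2) := by
  have hdivB : (∑ x : Site (F.P K) 0, ∑ j : Fin 2, ∑ k : Fin 2,
            ‖(divB (torusT (F.P K) 0) (fun κ z => unitsField (toUField U₀) ⟨z, κ⟩) (fun κ z => pertVar U₀ W ⟨z, κ⟩) x) j k‖ ^ 2)
      ≤ 0 * (∑ b : PBond (F.P K) 0, ‖pertVar U₀ W b‖ ^ 2) + 0 := by
    have h0 : ∀ x : Site (F.P K) 0, (∑ j : Fin 2, ∑ k : Fin 2,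
        ‖(divB (torusT (F.P K) 0) (fun κ z => unitsField (toUField U₀) ⟨z, κ⟩) (fun κ z => pertVar U₀ W ⟨z, κ⟩) x) j k‖ ^ 2) = 0 :=
      fun x => by rw [hdiv x]; simp
    rw [Finset.sum_eq_zero fun x _ => h0 x]
    simp
  have h := relPoincare_core_of_budgets_T3 F n K U₀ W hε hεL hU Q hQ0 hQs hdivB hQ hδW hs1
  simpa only [mul_zero, sub_zero] using h

/-! ## §3 ★★ At the unpinned `ℓ²`-optimum: `δ = 6s²`, `Z = 0` -/

/-- ★★ **THE CORE AT THE UNPINNED `ℓ²`-OPTIMAL (LANDAU) REPRESENTATIVE**: if `W` minimises `Σ_b‖(W^v)_bU₀(b)^* − 1‖²` over its FULL gauge orbit (no pinning; the letter of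
✓ `Prop7PointLandauBudget.sum_hs_divB_le_of_optAll`), then `D^*_{U₀}Y` is point-Landau at every site up to the exact quadratic term and the divergence budget is `δ = 6s²`,
`Z = 0`: `((1∕2)ℓ⁻² − A·(24582s² + 768(εℓ⁻²)²))·Σ_b‖Y_b‖² − 96ℓ⁻¹·ZQ ≤ A·4·Σ_p‖R_p − 1‖²` (`24582 = 24576 + 6`); displayed: (14), `Q`, `ZQ`, `s`.  NOTE: such a `W`
lies on the fibre of `V^{u↓}`, not of `V`; the coarse drift rides in `ZQ`. [cite: Balaban1985RegularSpaces, (1.38) p.82; Balaban1985BackgroundPropagators, Thm 3.11 p.416;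
Balaban1985Variational, (141)-(143) p.299] -/
theorem relPoincare_core_of_optAll_T3 (F : T3Family) (n K : ℕ)
    (U₀ W : GaugeField (F.P K) 0 (Matrix.specialUnitaryGroup (Fin 2) ℂ)) {ε : ℝ} (hε : 0 < ε) (hεL : 20000000000000 * (F.L : ℝ) ^ 9 * ε ≤ 1)
    (hU : ∀ p : Plaq (F.P K) 0, dist1 (GaugeField.plaqHol U₀ p) ≤ ε * (((F.L : ℝ) ^ (K - n)) ^ 2)⁻¹)
    (Q : (k : ℕ) → (PBond (F.P K) 0 → Matrix (Fin 2) (Fin 2) ℂ) → PBond (F.P K) k → Matrix (Fin 2) (Fin 2) ℂ) (hQ0 : ∀ Y, Q 0 Y = Y)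
    (hQs : ∀ (k : ℕ) (Y : PBond (F.P K) 0 → Matrix (Fin 2) (Fin 2) ℂ) (c : PBond (F.P K) (k + 1)), Q (k + 1) Y c
      = fderiv ℂ (eml : (Idx (F.P K) → Matrix (Fin 2) (Fin 2) ℂ) → Matrix (Fin 2) (Fin 2) ℂ)
            (fun i => ((loopHol (Averaging.iter (fun i => blockAvg (P := F.P K) (j := i) (expMeanLogSU (n := Fin 2))) k U₀) c i :
              Matrix.specialUnitaryGroup (Fin 2) ℂ) : Matrix (Fin 2) (Fin 2) ℂ))
            (fun i => covWalkSum (Averaging.iter (fun i => blockAvg (P := F.P K) (j := i) (expMeanLogSU (n := Fin 2))) k U₀) (Q k Y)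
                (walk (emb c.src) (loopWord (F.P K).L c.dir (off i.1) i.2.1 i.2.2))
              * ((loopHol (Averaging.iter (fun i => blockAvg (P := F.P K) (j := i) (expMeanLogSU (n := Fin 2))) k U₀) c i :
                Matrix.specialUnitaryGroup (Fin 2) ℂ) : Matrix (Fin 2) (Fin 2) ℂ))
            * star ((corr (expMeanLogSU (n := Fin 2)) (Averaging.iter (fun i => blockAvg (P := F.P K) (j := i) (expMeanLogSU (n := Fin 2))) k U₀) c :
                Matrix.specialUnitaryGroup (Fin 2) ℂ) : Matrix (Fin 2) (Fin 2) ℂ)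
          + ((corr (expMeanLogSU (n := Fin 2)) (Averaging.iter (fun i => blockAvg (P := F.P K) (j := i) (expMeanLogSU (n := Fin 2))) k U₀) c :
                Matrix.specialUnitaryGroup (Fin 2) ℂ) : Matrix (Fin 2) (Fin 2) ℂ)
            * covWalkSum (Averaging.iter (fun i => blockAvg (P := F.P K) (j := i) (expMeanLogSU (n := Fin 2))) k U₀) (Q k Y)
                (walk (emb c.src) (List.replicate (F.P K).L (c.dir, true)))
            * star ((corr (expMeanLogSU (n := Fin 2)) (Averaging.iter (fun i => blockAvg (P := F.P K) (j := i) (expMeanLogSU (n := Fin 2))) k U₀) c :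
                Matrix.specialUnitaryGroup (Fin 2) ℂ) : Matrix (Fin 2) (Fin 2) ℂ))
    (hopt : ∀ v : GaugeTransf (F.P K) 0 (Matrix.specialUnitaryGroup (Fin 2) ℂ),
      ∑ b : PBond (F.P K) 0, ‖pertVar U₀ W b‖ ^ 2 ≤ ∑ b : PBond (F.P K) 0, ‖pertVar U₀ (GaugeField.gaugeAct v W) b‖ ^ 2)
    {ZQ : ℝ} (hQ : ∑ c : PBond (F.P K) (K - n), ‖Q (K - n) (pertVar U₀ W) c‖ ^ 2 ≤ ZQ)
    {s : ℝ} (hδW : ∀ b : PBond (F.P K) 0, ‖pertVar U₀ W b‖ ≤ s) (hs1 : s ≤ 1) :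
    ((1 / 2) * (((F.L : ℝ) ^ (K - n)) ^ 2)⁻¹
        - (18 + 76800 * (F.L : ℝ) ^ 4) * (24582 * s ^ 2 + 768 * (ε * (((F.L : ℝ) ^ (K - n)) ^ 2)⁻¹) ^ 2)) * (∑ b : PBond (F.P K) 0, ‖pertVar U₀ W b‖ ^ 2)
        - 96 * ((F.L : ℝ) ^ (K - n))⁻¹ * ZQ
      ≤ (18 + 76800 * (F.L : ℝ) ^ 4) * (4 * ∑ p : Plaq (F.P K) 0,
        ‖((GaugeField.plaqHol W p : Matrix.specialUnitaryGroup (Fin 2) ℂ) : Matrix (Fin 2) (Fin 2) ℂ)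
          * star ((GaugeField.plaqHol U₀ p : Matrix.specialUnitaryGroup (Fin 2) ℂ) : Matrix (Fin 2) (Fin 2) ℂ) - 1‖ ^ 2) := by
  have hδ' : ∀ b : PBond (F.P K) 0, ‖(W b : Matrix (Fin 2) (Fin 2) ℂ) * star (U₀ b : Matrix (Fin 2) (Fin 2) ℂ) - 1‖ ≤ s := fun b => by
    rw [← pertVar_eq]; exact hδW b
  have hdiv6 := sum_hs_divB_le_of_optAll F U₀ W hopt hδ'
  simp only [← pertVar_eq] at hdiv6
  have hdivB : (∑ x : Site (F.P K) 0, ∑ j : Fin 2, ∑ k : Fin 2,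
            ‖(divB (torusT (F.P K) 0) (fun κ z => unitsField (toUField U₀) ⟨z, κ⟩) (fun κ z => pertVar U₀ W ⟨z, κ⟩) x) j k‖ ^ 2)
      ≤ (6 * s ^ 2) * (∑ b : PBond (F.P K) 0, ‖pertVar U₀ W b‖ ^ 2) + 0 := by
    simpa only [add_zero] using hdiv6
  have h := relPoincare_core_of_budgets_T3 F n K U₀ W hε hεL hU Q hQ0 hQs hdivB hQ hδW hs1
  have hA0 : (0 : ℝ) ≤ 18 + 76800 * (F.L : ℝ) ^ 4 := by positivity
  nlinarith [h, hA0, sq_nonneg s, Finset.sum_nonneg (fun b (_ : b ∈ (Finset.univ : Finset (PBond (F.P K) 0))) => sq_nonneg ‖pertVar U₀ W b‖)]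

end Summit.QuantumFields.YangMills.Theorems.Prop7CurvedLandauCoreBudgetsRelPlaqT3

end
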